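import Mathlib
import Summits.CriticalPhenomena.PercolationContinuityZ3.Theorems.PercNearOneGluingNoHeavyLowerTailTreeEmbedding
import Summits.CriticalPhenomena.PercolationContinuityZ3.Theorems.PercNearOneGluingNoHeavyLowerTailGameCountTree

/-!
# Adaptive (causal) schedules: the quantifier-game count is schedule-independent; K♯ from cross-schedule domination (hp-7 gen 84)

Helper file for crux `stmt-CriticalPhenomena-4575` (`NoHeavyLowerTail`, route `PercNearOneGluingNoHeavy`), hull-port seat
`prim-hp-7` (generation 84); `--supports stmt-CriticalPhenomena-4575`.  Pure finite set theory; everything is PROVED.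
Memo: `run/shared/lean/prim/prim-hp-7/FROM-prim-hp-7-g84-TREE-BIJECTION.md` §0 (F)(3).

A **schedule tree** `t : STree α` decides which coordinate is played next from the bits played so far (`node r t₀ t₁`: play `r`,
continue with `t₀` in the `0`-fibre and with `t₁` in the `1`-fibre); `t.Full G` says every root–leaf path queries each coordinate of `G`
exactly once.  A **quantifier word** is a list of Booleans read in TIME order (`true` = ∀ = Adversary sets the bit, `false` = ∃ = Verifier);
`wins t X w` (Boolean) says that Verifier can force the final set into `X` when the schedule is `t` and the word is `w`.
**`card_eq_card_wins`**: for every full schedule `t`, `#X = #{w ∈ words #G | wins t X w}` — the gen-83 counting identity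
(`GameCount.card_eq_gameCount`, fixed processing order) holds for ARBITRARY causal schedules, and the right-hand side does not depend on
`t`.  Consequently (**`card_le_card_of_wins_imp`**) if for SOME PAIR of full schedules `tX, tY` every word won by `X` under `tX` is won by
`Y` under `tY`, then `#X ≤ #Y`; and **`kSharp_of_scheduleDomination`** reduces Conjecture K♯ to such a (cross-)schedule domination of the
debtor game by the resolved game — the most flexible of the game reductions (fixed order ⊂ schedule; the tree bijections of
`…LowerTailTreeEmbedding` are refuted in general, memo §0 (B), schedules are not).  NB a schedule may depend on past bits, never on future
quantifiers (memo §0 (F)(3): with look-ahead the count fails already for two coordinates).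
-/

namespace Summit.CriticalPhenomena.PercolationContinuityZ3.Theorems

namespace GameSchedule

open Finset TreeBijection GameCount

variable {α : Type*} [DecidableEq α]

/-- A causal schedule: `leaf` (nothing left to play) or `node r t₀ t₁` — play coordinate `r`, then continue with `t₀` if the bit was `0`
and with `t₁` if it was `1`. -/
inductive STree (α : Type*)
  | leaf : STree α
  | node : α → STree α → STree α → STree α

/-- `Full G t`: along every path the schedule `t` plays each coordinate of the ground set `G` exactly once. -/
inductive Full : Finset α → STree α → Prop
  | leaf : Full ∅ STree.leaf
  | node (G : Finset α) (r : α) (t₀ t₁ : STree α) (hr : r ∈ G) (h₀ : Full (G.erase r) t₀) (h₁ : Full (G.erase r) t₁) :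
      Full G (STree.node r t₀ t₁)

/-- `wins t X w`: Verifier forces the played set into `X` under schedule `t` and time-ordered quantifier word `w` (`true` = ∀-move).
At the end of the word the empty set must lie in the (iterated fibre of the) family. -/
def wins : STree α → Finset (Finset α) → List Bool → Bool
  | STree.leaf, X, [] => decide ((∅ : Finset α) ∈ X)
  | STree.leaf, _, (_ :: _) => false
  | STree.node _ _ _, X, [] => decide ((∅ : Finset α) ∈ X)
  | STree.node r t₀ t₁, X, (q :: w) =>
      if q then (wins t₀ (fib0 X r) w && wins t₁ (fib1 X r) w) else (wins t₀ (fib0 X r) w || wins t₁ (fib1 X r) w)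

/-- All Boolean words of length `k`. -/
def words : ℕ → Finset (List Bool)
  | 0 => {[]}
  | k + 1 => (words k).image (List.cons false) ∪ (words k).image (List.cons true)

/-- Counting over words of length `k+1` splits according to the first letter. -/
theorem card_filter_words_succ (k : ℕ) (P : List Bool → Bool) :
    #{w ∈ words (k + 1) | P w = true} =
      #{w ∈ words k | P (false :: w) = true} + #{w ∈ words k | P (true :: w) = true} := by
  have hdis : Disjoint (((words k).image (List.cons false)).filter (fun w => P w = true))
      (((words k).image (List.cons true)).filter (fun w => P w = true)) := by
    rw [disjoint_left]
    intro w h1 h2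
    rw [mem_filter, mem_image] at h1 h2
    obtain ⟨⟨a, -, rfl⟩, -⟩ := h1
    obtain ⟨⟨b, -, hb⟩, -⟩ := h2
    have := (List.cons_eq_cons.mp hb).1
    exact absurd this (by decide)
  have h1 : #(((words k).image (List.cons false)).filter (fun w => P w = true)) = #{w ∈ words k | P (false :: w) = true} := by
    rw [filter_image, card_image_of_injective _ (List.cons_injective)]
  have h2 : #(((words k).image (List.cons true)).filter (fun w => P w = true)) = #{w ∈ words k | P (true :: w) = true} := by
    rw [filter_image, card_image_of_injective _ (List.cons_injective)]
  rw [show words (k + 1) = (words k).image (List.cons false) ∪ (words k).image (List.cons true) from rfl,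
    filter_union, card_union_of_disjoint hdis, h1, h2]

/-- Inclusion–exclusion for Boolean predicates: `#{A ∨ B} + #{A ∧ B} = #{A} + #{B}`. -/
theorem card_filter_or_add_card_filter_and {β : Type*} [DecidableEq β] (s : Finset β) (A B : β → Bool) :
    #{x ∈ s | (A x || B x) = true} + #{x ∈ s | (A x && B x) = true} = #{x ∈ s | A x = true} + #{x ∈ s | B x = true} := by
  have hor : {x ∈ s | (A x || B x) = true} = {x ∈ s | A x = true} ∪ {x ∈ s | B x = true} := by
    ext x; simp only [mem_filter, mem_union, Bool.or_eq_true]; tauto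
  have hand : {x ∈ s | (A x && B x) = true} = {x ∈ s | A x = true} ∩ {x ∈ s | B x = true} := by
    ext x; simp only [mem_filter, mem_inter, Bool.and_eq_true]; tauto
  rw [hor, hand, card_union_add_card_inter]

/-- Members of the `0`-fibre lie in the ground minus the split coordinate. -/
theorem subset_erase_of_mem_fib0 {X : Finset (Finset α)} {G : Finset α} {r : α} (hX : ∀ S ∈ X, S ⊆ G)
    {S : Finset α} (hS : S ∈ fib0 X r) : S ⊆ G.erase r := by
  rw [mem_fib0] at hS
  intro x hx
  rw [mem_erase]
  exact ⟨fun h => hS.2 (h ▸ hx), hX S hS.1 hx⟩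

/-- Members of the `1`-fibre lie in the ground minus the split coordinate. -/
theorem subset_erase_of_mem_fib1 {X : Finset (Finset α)} {G : Finset α} {r : α} (hX : ∀ S ∈ X, S ⊆ G)
    {S : Finset α} (hS : S ∈ fib1 X r) : S ⊆ G.erase r := by
  rw [mem_fib1] at hS
  intro x hx
  rw [mem_erase]
  exact ⟨fun h => hS.1 (h ▸ hx), hX (insert r S) hS.2 (mem_insert_of_mem hx)⟩

/-- **The counting identity for causal schedules** (hp-7 gen 84): for every schedule `t` full on `G` and every family `X` of subsets of
`G`, the number of members of `X` equals the number of quantifier words (of length `#G`) under which Verifier forces the played set into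
`X`.  In particular the right-hand side does not depend on the schedule. -/
theorem card_eq_card_wins {G : Finset α} {t : STree α} (ht : Full G t) :
    ∀ (X : Finset (Finset α)), (∀ S ∈ X, S ⊆ G) → #X = #{w ∈ words G.card | wins t X w = true} := by
  induction ht with
  | leaf =>
    intro X hX
    rw [card_eq_ite_of_subset_empty X hX, card_empty]
    unfold words
    rw [filter_singleton]
    unfold wins
    by_cases h : (∅ : Finset α) ∈ X
    · rw [if_pos h, decide_eq_true h, if_pos rfl, card_singleton]
    · rw [if_neg h, decide_eq_false h]; simp
  | node G r t₀ t₁ hr h₀ h₁ ih₀ ih₁ =>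
    intro X hX
    rw [card_eq_card_fib0_add_card_fib1 X r, ← card_erase_add_one hr, card_filter_words_succ]
    have e0 : ∀ w, wins (STree.node r t₀ t₁) X (false :: w) = (wins t₀ (fib0 X r) w || wins t₁ (fib1 X r) w) := by
      intro w; simp [wins]
    have e1 : ∀ w, wins (STree.node r t₀ t₁) X (true :: w) = (wins t₀ (fib0 X r) w && wins t₁ (fib1 X r) w) := by
      intro w; simp [wins]
    simp only [e0, e1]
    rw [card_filter_or_add_card_filter_and,
      ih₀ (fib0 X r) (fun S hS => subset_erase_of_mem_fib0 hX hS), ih₁ (fib1 X r) (fun S hS => subset_erase_of_mem_fib1 hX hS)]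

/-- **Cross-schedule domination bounds the cardinality** (hp-7 gen 84): if `tX` and `tY` are schedules full on `G` (possibly different),
all members of `X` and `Y` lie in `G`, and every quantifier word won by `X` under `tX` is won by `Y` under `tY`, then `#X ≤ #Y`. -/
theorem card_le_card_of_wins_imp {G : Finset α} {tX tY : STree α} (htX : Full G tX) (htY : Full G tY)
    {X Y : Finset (Finset α)} (hX : ∀ S ∈ X, S ⊆ G) (hY : ∀ S ∈ Y, S ⊆ G)
    (h : ∀ w, wins tX X w = true → wins tY Y w = true) : #X ≤ #Y := by
  rw [card_eq_card_wins htX X hX, card_eq_card_wins htY Y hY]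
  apply card_le_card
  intro w hw
  rw [mem_filter] at hw ⊢
  exact ⟨hw.1, h w hw.2⟩

end GameSchedule

/-! ### K♯ from (cross-)schedule domination of the debtor game by the resolved game -/

namespace GeneratedDonors

open Finset OrientedAntipodalHall AntipodalStrongHarris AntipodalStrongHarris.Lab GameSchedule

variable {α : Type} [Fintype α] [DecidableEq α]

/-- **K♯ from schedule domination** (hp-7 gen 84): if for some pair of causal schedules, both full on all coordinates, every quantifier word
under which Verifier forces a debtor set (schedule `tX`) also lets her force a resolved set (schedule `tY`), then the K♯ inequality holds at
`(g, h)`. -/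
theorem kSharp_ineq_of_scheduleDomination (g h : Finset α → Lab 3) (tX tY : STree α)
    (htX : Full (univ : Finset α) tX) (htY : Full (univ : Finset α) tY)
    (hdom : ∀ w, wins tX (debtors g h) w = true → wins tY (resolved g h) w = true) :
    #{q ∈ (univ : Finset (Finset α)) | IsCharged 3 g h q} ≤
      #{q ∈ (univ : Finset (Finset α)) | (g q = top ∧ h (univ \ q) = bot) ∨ (g (univ \ q) = top ∧ h q = bot)} :=
  kSharp_ineq_of_card_debtors_le_card_resolved g h
    (card_le_card_of_wins_imp htX htY (fun S _ => subset_univ S) (fun S _ => subset_univ S) hdom)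

/-- **Conjecture K♯ follows from schedule domination** (hp-7 gen 84, the most flexible game reduction): if for every pair of monotone
labellings there are causal schedules `tX, tY` (Verifier may choose the next coordinate from the bits played so far, separately in the two
games) such that the resolved game under `tY` is won whenever the debtor game under `tX` is won, then `KSharp 3`. -/
theorem kSharp_of_scheduleDomination
    (H : ∀ (α : Type) [Fintype α] [DecidableEq α] (g h : Finset α → Lab 3),
      (∀ ⦃X Y : Finset α⦄, X ⊆ Y → g X ≤ g Y) → (∀ ⦃X Y : Finset α⦄, X ⊆ Y → h X ≤ h Y) →
        ∃ tX tY : STree α, Full (univ : Finset α) tX ∧ Full (univ : Finset α) tY ∧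
          ∀ w, wins tX (debtors g h) w = true → wins tY (resolved g h) w = true) :
    KSharp 3 := by
  intro α _ _ g h hg hh
  obtain ⟨tX, tY, htX, htY, hdom⟩ := H α g h hg hh
  exact kSharp_ineq_of_scheduleDomination g h tX tY htX htY hdom

end GeneratedDonors

end Summit.CriticalPhenomena.PercolationContinuityZ3.Theorems
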